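import Summits.HodgeConjecture.CorCM.MumfordTateRankRibetTypeOneData
import Summits.HodgeConjecture.CorCM.MumfordTateRankRigidMonotone
import Literature.AlgebraicGeometry.Motives.HodgeLieRigidOfCenterRankLeOne
import HarnessLib

/-!
# Every abelian variety with imaginary-quadratic `End⁰` and UNBALANCED multiplicities is `Θ`-rigid
# (`dim_ℚ End⁰A = 2`, `φ ∘ φ = −d`, `n_{i√d} ≠ n_{−i√d}`: the centre of `Lie Hg(H¹A)` lies on `ℚφ^*` and `tr(Θ_A φ^*) = 2i√d(n′ − n″) ≠ 0`)

COR-CM (cell `pub-hodgecm2`, seat `b27` gen 54, count-neutral Mumford–Tate-rank ladder; theorems only, no definition, no named fact; UNCONDITIONAL —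
nothing here uses or asserts HC_CM).  The ladder knew `Θ`-rigidity of `H¹A` for RIBET TYPE `(g−1,1)` (multiplicity ONE at `±i√d`,
`CorCM/MumfordTateRankRigidMonotone.hodgeLie_rigid_of_ribetTypeOne`, via the unitary `Θ`-subalgebra theorem `Lie Hg = 𝔲`).  With gen 54ʼs
centre criterion (`Motives/HodgeLieRigidOfCenterRankLeOne`) the signature is irrelevant: for ANY complex abelian variety `A` with
`dim_ℚ End⁰A = 2`, `φ ∘ φ = −d` (`d > 0`) and `n_{i√d} ≠ n_{−i√d}` (multiplicities of `φ` on `H^{1,0}`), the `ψ`-skew central Hodge endomorphisms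
are `ℚφ^*` (`quadraticEnd_skewCentre_data`), so `dim 𝔷(Lie Hg(H¹A)) ≤ 1`, and `tr(φ^*_ℂ Θ_A) = 2i√d(n_{i√d} − n_{−i√d}) ≠ 0`
(`trace_theta_mul_baseChange_pullback_eq`, Gordon 1.13.2) — whatever `Lie Hg(H¹A)` is.
* **`hodgeLie_rigid_of_quadraticEnd_of_ne`** — `H¹(A)` is `Θ`-rigid;
* **`mtRank_hodge_one_le_of_isIsogenous_quadraticEnd_prod`** — `t(X) ≥ t(A)` for every `X ∼ A × Y`.
(Balanced multiplicities — Weil type — have `tr(Θ_A φ^*) = 0`; there rigidity is equivalent to `φ^* ∉ Lie Hg(H¹A)`,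
`Motives/HodgeLieRigidityTraceCriterion`.)

## References
* [MoonenZarhin1999LowDim] B. Moonen, Yu. G. Zarhin, *Hodge classes on abelian varieties of low dimension*, Math. Ann. 315 (1999), §2 (2.3), §3 (3.1)
  [corpus: paper:arxiv-math_9901113 pp. 5–6]. [cite: MoonenZarhin1999LowDim, §3 (3.1)]
* [Gordon1997] B. B. Gordon, *A survey of the Hodge conjecture for abelian varieties*, 1.13.2. [cite: Gordon1997, 1.13.2]
* [Deligne1982HodgeCycles] P. Deligne, LNM 900 (1982), I §3 Prop. 3.6. [cite: Deligne1982HodgeCycles, I §3 Prop. 3.6]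
-/

noncomputable section

open scoped TensorProduct
open CategoryTheory CategoryTheory.Limits Module NumberField

namespace Summit.HodgeConjecture.CorCM

open Literature.AlgebraicGeometry.Motives
open Literature.AlgebraicGeometry.Motives.AbelianVariety
open Literature.AlgebraicGeometry.Motives.HodgeStructure
open Literature.AlgebraicGeometry.HodgeTheory
open Literature.AlgebraicGeometry.ComplexMultiplication

variable [HodgeTensorFacts.{0, 0}] {X A : AbelianVariety ℂ} {n : ℕ}

/-- **Imaginary-quadratic `End⁰` with unbalanced multiplicities ⟹ `Θ`-rigid**: for a complex abelian variety `A` with `dim_ℚ End⁰A = 2`,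
`φ ∘ φ = −d` (`d > 0`) and `n_{i√d} ≠ n_{−i√d}`, every bracket-closed rational `𝔞 ⊆ Lie Hg(H¹A)` whose complex span contains a Hodge operator is
`Lie Hg(H¹A)` (centre `⊆ ℚφ^*`, `tr(φ^*_ℂ Θ) = 2i√d(n_{i√d} − n_{−i√d}) ≠ 0`, `rigid_of_finrank_center_le_one`).
[cite: MoonenZarhin1999LowDim, §3 (3.1)] [cite: Gordon1997, 1.13.2] [cite: Deligne1982HodgeCycles, I §3 Prop. 3.6] -/
theorem hodgeLie_rigid_of_quadraticEnd_of_ne (hA : IsSmoothProjective n A.X) (h0 : 0 < A.dim) (hAE : Module.finrank ℚ A.endAlgebra = 2)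
    (φ : A ⟶ A) {d : ℕ} (hd : 0 < d) (hφ : φ ≫ φ = -(d • 𝟙 A))
    (hne : eigenMultiplicity A φ (Complex.I * (Real.sqrt d : ℂ)) ≠ eigenMultiplicity A φ (-(Complex.I * (Real.sqrt d : ℂ)))) :
    haveI := BettiUniverse.finite hA 1
    ∀ 𝔞 : Submodule ℚ (Module.End ℚ (bettiCohomology A.X 1)),
      𝔞 ≤ (BettiUniverse.hodge exists_isReal_hodgeModel_holds hA 1).hodgeLie →
      (∀ X' ∈ 𝔞, ∀ Y ∈ 𝔞, X' * Y - Y * X' ∈ 𝔞) →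
      (∃ Θ ∈ Submodule.span ℂ ((fun X' : Module.End ℚ (bettiCohomology A.X 1) => X'.baseChange ℂ) ''
          (𝔞 : Set (Module.End ℚ (bettiCohomology A.X 1)))),
        ∀ p, ∀ x ∈ (BettiUniverse.hodge exists_isReal_hodgeModel_holds hA 1).piece p (((1 : ℕ) : ℤ) - p),
          Θ x = ((2 * p - ((1 : ℕ) : ℤ) : ℤ) : ℂ) • x) →
      (BettiUniverse.hodge exists_isReal_hodgeModel_holds hA 1).hodgeLie ≤ 𝔞 := by
  classical
  have hnA : A.dim = n := schemeDim_eq_holds hA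
  subst hnA
  haveI := BettiUniverse.finite hA 1
  set H := BettiUniverse.hodge exists_isReal_hodgeModel_holds hA 1 with hHdef
  set φQ : Module.End ℚ (bettiCohomology A.X 1) := (bettiCohomology.map φ.hom.hom.hom 1).hom with hφQ
  obtain ⟨ψ⟩ := BettiUniverse.hodge_isPolarizable exists_isReal_hodgeModel_holds hA 1
  obtain ⟨hφE, -, hZ⟩ := quadraticEnd_skewCentre_data exists_isReal_hodgeModel_holds hodgePQ_independent_of_hodgeModel_holds h0 hAE hd hφ ψ
  -- the centre of `Lie Hg(H¹A)` lies on `ℚ φ^*`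
  set P : Submodule ℚ (Module.End ℚ (bettiCohomology A.X 1)) :=
    Submodule.span ℚ ((({φQ} : Finset (Module.End ℚ (bettiCohomology A.X 1))) : Set _)) with hPdef
  have hφP : φQ ∈ P := Submodule.subset_span (by rw [Finset.coe_singleton]; exact Set.mem_singleton _)
  have h𝔷le : H.hodgeLie ⊓ Subalgebra.toSubmodule H.endAlg ≤ P := by
    intro z hz
    obtain ⟨hz𝔥, hzE⟩ := Submodule.mem_inf.1 hz
    obtain ⟨x, rfl⟩ := hZ z hzE (fun b hb => commute_of_mem_hodgeLie _ hz𝔥 ⟨b, hb⟩) (form_apply_add_eq_zero_of_mem_hodgeLie ψ hz𝔥)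
    exact P.smul_mem _ hφP
  have h𝔷1 : Module.finrank ℚ ↥(H.hodgeLie ⊓ Subalgebra.toSubmodule H.endAlg) ≤ 1 :=
    (Submodule.finrank_mono h𝔷le).trans ((finrank_span_finset_le_card _).trans (Finset.card_singleton _).le)
  -- `tr(φ^*_ℂ Θ) = 2i√d(n′ − n″) ≠ 0`
  obtain ⟨Θ₀, hΘ₀⟩ := exists_hodgeTheta H
  have htr : LinearMap.trace ℂ _ (φQ.baseChange ℂ * Θ₀) =
      2 * (Complex.I * (Real.sqrt d : ℂ)) *
        ((eigenMultiplicity A φ (Complex.I * (Real.sqrt d : ℂ)) : ℂ) - (eigenMultiplicity A φ (-(Complex.I * (Real.sqrt d : ℂ))) : ℂ)) := by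
    rw [LinearMap.trace_mul_comm, hφQ]
    exact trace_theta_mul_baseChange_pullback_eq exists_isReal_hodgeModel_holds hodgePQ_independent_of_hodgeModel_holds φ hd hφ hΘ₀
  have hcΘ : LinearMap.trace ℂ _ (φQ.baseChange ℂ * Θ₀) ≠ 0 := by
    rw [htr]
    refine mul_ne_zero (mul_ne_zero two_ne_zero (mul_ne_zero Complex.I_ne_zero ?_)) ?_
    · exact_mod_cast (Real.sqrt_pos.2 (by exact_mod_cast hd)).ne'
    · rw [sub_ne_zero]
      exact_mod_cast hne
  exact rigid_of_finrank_center_le_one H ⟨ψ⟩ hΘ₀ h𝔷1 hφE hcΘ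

/-- **`t(X) ≥ t(A)` for `X ∼ A × Y`**, `A` with imaginary-quadratic `End⁰` and unbalanced multiplicities (any `Y`): such an `A` is a monotone
factor of the ladder (`mtRank_hodge_one_le_of_isIsogenous_prod_of_rigid`). [cite: MoonenZarhin1999LowDim, §3 (3.1)] [cite: Gordon1997, 1.13.2] -/
theorem mtRank_hodge_one_le_of_isIsogenous_quadraticEnd_prod (hX : IsSmoothProjective n X.X) {Y : AbelianVariety ℂ} {m : ℕ}
    (hA : IsSmoothProjective m A.X) (h0 : 0 < A.dim) (hAE : Module.finrank ℚ A.endAlgebra = 2)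
    (φ : A ⟶ A) {d : ℕ} (hd : 0 < d) (hφ : φ ≫ φ = -(d • 𝟙 A))
    (hne : eigenMultiplicity A φ (Complex.I * (Real.sqrt d : ℂ)) ≠ eigenMultiplicity A φ (-(Complex.I * (Real.sqrt d : ℂ))))
    (hXP : IsIsogenous X (A.prod Y)) :
    haveI := BettiUniverse.finite hX 1
    haveI := BettiUniverse.finite hA 1
    (BettiUniverse.hodge exists_isReal_hodgeModel_holds hA 1).mtRank ≤ (BettiUniverse.hodge exists_isReal_hodgeModel_holds hX 1).mtRank :=
  mtRank_hodge_one_le_of_isIsogenous_prod_of_rigid hX hA h0 (hodgeLie_rigid_of_quadraticEnd_of_ne hA h0 hAE φ hd hφ hne) hXP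

end Summit.HodgeConjecture.CorCM

end
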